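import Summits.QuantumFields.BalabanUV.Beta.KernelWardRelative
import Summits.QuantumFields.BalabanUV.Beta.FP.PerfectBubbleSandwich
import Summits.QuantumFields.BalabanUV.Beta.FP.RoadEndGeneric

/-!
# `BalabanUV.Beta.FP.PerfectWardLetters` — road «FP» for binder row D1, «STEP-NO-HW», COMB INSTANCE: `TPerfOf n K S W = TGenOf n (Π K Π) (Π K Π) S W`
# (rfl-level; undressed stencils, the dressed leg in BOTH slots) and Ward transversality of `flipK (TPerfOf n K S W)` from an1's four coarse letters for `Π K Π`

HONEST DEPENDENCY (page 1, mandatory): continuum YM on T⁴ ⇐ BetaPertH ∧ nine spine estimates (0/9 proved); BetaPertH ⇐ (D1) ∧ (D4) ∧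
CAP+tail; G-an2-4 gates asym, D1 and NE2/3/4.  HONEST FRAMING (cell contract, verbatim): «discharging `BetaPertH` makes Bałaban's UV
stability UNCONDITIONAL — a real constructive-QFT result; it is NOT the continuum limit and NOT the Clay problem.»  THIS MODULE DISCHARGES
NOTHING of D1 / BetaPertH: it is [our object] bookkeeping BY NAME over an1's `KernelWardRelative.wardTransversal_flipK_hessKer_conj_rel` (the `hW` END over a
relative inverse), the road FP owner's `RoadEndGeneric.TGenOf` (R-FP-13) and gen 3's `PerfectBubbleExpansion.axProj_colH` / `PerfectBubbleSandwich.axDressK_blockCov`.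
No `def`, no `Prop` mirror, no cited fact, 0 sorry; every letter below is a DISPLAYED hypothesis, none instantiated at a value; 0∕4 binders of row D1 discharged;
NOT D1, NOT BetaPertH, NOT continuum, NOT Clay.

ABSOLUTE RULE (cell charter, verbatim): «No internally-minted statement may enter as a cited fact. Every hypothesis is either
kernel-proved in this package or a verbatim quotation of a PUBLISHED theorem with page reference. The manuscript(s) under audit are NOT
citable for their own disputed steps — they are the thing under adjudication; programme-internal (2001/route/tribunal) claims are never
citable.»

WHY (road FP owner's question «STEP-NO-HW?», journal 2026-08-20T15:20:14Z; leaf-01-g5's short route 15:22:21Z; owner ruling R-FP-13 (c), 15:49Z).  Road FP's END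
(generic form `StepLawWardGeneric.d1Drift_of_generic_ward_symm_explicitDefect`, comb worked instance `RoadWardExplicit` p222952 / `StepLawWardPerf` p223962) consumes
the Ward transversality `hWf` ∕ `hWperf` of the flipped PERFECT ONE-STEP kernel; leaf-01-g6's `FP/LetterInheritanceEnd` (p224402) gives it at ANY triple in the generic
shape `hessKer K (vertexOfK K N S) W` from an1's four COARSE letters.  THIS FILE is the COMB-INSTANCE bookkeeping:
* §1 (rfl-level identification) `colH (axDressK N K) N μ y = colH (legAx₁ N K) N μ y = axProj N (colH K N μ y)` (the second-leg dressing `legAx₂` does not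
  touch the multiplier column; gen 3's `axProj_colH`), hence `vertexOfK (axDressK N K) N S = axVertexOfK K N S`,
  `TPerfOf n K S W = hessKer (axDressK n K) (vertexOfK (axDressK n K) n S) W` and **`TPerfOf n K S W = TGenOf n (Π K Π) (Π K Π) S W`** — the comb kernel is a
  DIAGONAL four-slot instance of the owner's `RoadEndGeneric.TGenOf` with UNDRESSED stencils (no hypothesis; the owner's `TPerfOf_eq_TGenOf` gives the
  off-diagonal reading `(Π K Π, K, Πᵀ S, W)` under decay ∕ locality), i.e. exactly the shape in which an1's END ∕ leaf-01-g6's generic wrapper apply;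
* §2 the COMB instance **`wardTransversal_flipK_TPerfOf_of_letters`**: for ANY `n ≥ 1`, `K` (decaying, coarse-translation invariant), local stencils `S` (class +
  (St), own rate) and tables `W` (class + (Wt), own rate), an1's FOUR COARSE LETTERS for the dressed leg `A := Π K Π` — (K) `RelInv A 𝕄 E`, (H) the ℋ-column law of
  `colH A n`, (S) the block-stencil law, (W) the second-order pure-gauge law displayed over road FP's `axVertexOfK K n S` (+ `X`∕`X₂`∕`Nr`, tadpole-null `Nr`) ⟹
  `WardTransversal (flipK (TPerfOf n K S W))` — the socket `hWperf` of `FP/StepLawWardPerf`; `…_of_letters'` = letter (W) in an1's literal shape.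
NOT HERE: the generic shape and `hH_of_tendsto` (leaf-01-g6 `LetterInheritanceEnd`, p224402 — not duplicated), the INSTANTIATION at the families of record (row
HH-INHERIT-G).  For the comb literal there is no finite-`j` letter supplier in the tree (R-FP-13 (e)); §2 is the worked shape for the v2.21 instance p222952.
Unit `b2b-balaban-beta-d1-formalise-leaf-02` (gen 5).
-/

noncomputable section

namespace Summit.QuantumFields.BalabanUV.Beta.FP.PerfectWardLetters

open Finset
open scoped BigOperators
open Literature.MathematicalPhysics.QuantumFieldTheory
open Literature.MathematicalPhysics.QuantumFieldTheory.Balaban1983to89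
open Literature.MathematicalPhysics.QuantumFieldTheory.Balaban1983to89.Beta
open B6BondElimination (unitVec)
open ExpKernelCalculus (MKer Decays BiLoc comp tadpole hessKer VertexFamily₂ shiftK)
open PolarizationSign (WardTransversal)
open KernelWard (divV divW)
open AffineAveraging (box toSite)
open OneStepResolventKernel (Fib wsum LocStencil JetData)
open OneStepKernelFamily (colH vertexOfK flipK)
open AxialProjector (axProj)
open AxialDressing (legAx₁ legAx₂ axDressK axVertexOfK decays_axDressK cAx_nonneg)
open Summit.QuantumFields.BalabanUV.Beta.TameKernelCalculus
open Summit.QuantumFields.BalabanUV.Beta.ChartConjugation (conjV conjW)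
open Summit.QuantumFields.BalabanUV.Beta.ChartConjugationRelative (RelInv)
open Summit.QuantumFields.BalabanUV.Beta.KernelWardRelative (gaugeWt wardTransversal_flipK_hessKer_conj_rel)
open Summit.QuantumFields.BalabanUV.Beta.FP.PerfectObjectsT (TPerfOf)
open Summit.QuantumFields.BalabanUV.Beta.FP.RoadEndGeneric (TGenOf)
open Summit.QuantumFields.BalabanUV.Beta.FP.PerfectBubbleExpansion (axProj_colH axVertexOfK_eq_vertexOfK_legAx₁)
open Summit.QuantumFields.BalabanUV.Beta.FP.PerfectBubbleSandwich (axDressK_blockCov)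

/-! ## §1 The identification: the ℋ-column and the chain-rule vertex of the `Π`-conjugated leg -/

section Identification

variable {d : ℕ}

/-- [our object] **THE ℋ-COLUMN OF `Π K Π` IS THE ℋ-COLUMN OF `Π K`** (definitional: the second-leg dressing `legAx₂` leaves the multiplier column
untouched, `AxialDressing.legAx₂_inr`). -/
theorem colH_axDressK (N : ℕ) (K : MKer (d + 1) (Fib d)) (μ : Fin (d + 1)) (y : Fin (d + 1) → ℤ) :
    colH (axDressK N K) N μ y = colH (legAx₁ N K) N μ y := by
  funext κ' u
  rfl

/-- [our object] Hence `colH (Π K Π) = Π (colH K)` (gen 3's `PerfectBubbleExpansion.axProj_colH`). -/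
theorem colH_axDressK_eq_axProj (N : ℕ) (K : MKer (d + 1) (Fib d)) (μ : Fin (d + 1)) (y : Fin (d + 1) → ℤ) :
    colH (axDressK N K) N μ y = axProj N (colH K N μ y) := by
  rw [colH_axDressK, axProj_colH]

/-- [our object] **THE CHAIN-RULE VERTEX THROUGH `Π K Π` IS THE `Π`-DRESSED CHAIN-RULE VERTEX THROUGH `K`**:
`vertexOfK (axDressK N K) N S = axVertexOfK K N S`. -/
theorem vertexOfK_axDressK (N : ℕ) (K : MKer (d + 1) (Fib d)) (S : Fin (d + 1) → (Fin (d + 1) → ℤ) → MKer (d + 1) (Fib d)) :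
    vertexOfK (axDressK N K) N S = axVertexOfK K N S := by
  rw [axVertexOfK_eq_vertexOfK_legAx₁]
  funext μ y x z a b
  simp only [OneStepKernelFamily.vertexOfK, colH_axDressK]

/-- [our object] **THE PERFECT ∕ ONE-STEP POLARIZATION KERNEL IN an1's PACKED SHAPE**: `TPerfOf n K S W = hessKer A (vertexOfK A n S) W` with the DRESSED leg
`A := axDressK n K` in BOTH slots — the exact shape of `KernelWardRelative.wardTransversal_flipK_hessKer_conj_rel`'s conclusion. -/
theorem TPerfOf_eq_hessKer_vertexOfK (n : ℕ) (K : MKer (3 + 1) (Fib 3)) (S : Fin (3 + 1) → (Fin (3 + 1) → ℤ) → MKer (3 + 1) (Fib 3))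
    (W : Fin (3 + 1) → (Fin (3 + 1) → ℤ) → Fin (3 + 1) → (Fin (3 + 1) → ℤ) → MKer (3 + 1) (Fib 3)) :
    TPerfOf n K S W = hessKer (axDressK n K) (vertexOfK (axDressK n K) n S) W := by
  rw [vertexOfK_axDressK]
  rfl

/-- [our object] **THE COMB KERNEL IS A DIAGONAL FOUR-SLOT INSTANCE WITH UNDRESSED STENCILS**: in the road FP owner's generic shape
(`RoadEndGeneric.TGenOf n A K S W := hessKer A (vertexOfK K n S) W`, R-FP-13) `TPerfOf n K S W = TGenOf n (Π K Π) (Π K Π) S W` — the SAME kernel in both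
slots, no hypothesis (compare the owner's `TPerfOf_eq_TGenOf`: `= TGenOf n (Π K Π) K (Πᵀ S) W` under decay ∕ locality).  The diagonal shape is the one in which
an1's coarse `hW` END ∕ leaf-01-g6's generic `LetterInheritanceEnd.wardTransversal_flipK_hessKer_vertexOfK_of_letters` apply (§2). -/
theorem TPerfOf_eq_TGenOf_diag (n : ℕ) (K : MKer (3 + 1) (Fib 3)) (S : Fin (3 + 1) → (Fin (3 + 1) → ℤ) → MKer (3 + 1) (Fib 3))
    (W : Fin (3 + 1) → (Fin (3 + 1) → ℤ) → Fin (3 + 1) → (Fin (3 + 1) → ℤ) → MKer (3 + 1) (Fib 3)) :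
    TPerfOf n K S W = TGenOf n (axDressK n K) (axDressK n K) S W :=
  TPerfOf_eq_hessKer_vertexOfK n K S W

end Identification



/-! ## §2 The comb instance: Ward transversality of `flipK (TPerfOf n K S W)` from the four coarse letters for the dressed leg `Π K Π` -/

section Letters

variable {n : ℕ} {K M E : MKer (3 + 1) (Fib 3)}
  {S : Fin (3 + 1) → (Fin (3 + 1) → ℤ) → MKer (3 + 1) (Fib 3)} {Cs δS : ℝ}
  {W : Fin (3 + 1) → (Fin (3 + 1) → ℤ) → Fin (3 + 1) → (Fin (3 + 1) → ℤ) → MKer (3 + 1) (Fib 3)} {Cw δW : ℝ}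

/-- [our object] The `Π`-conjugated leg keeps a decay datum of an1's shape `∃ δ C, 0 < δ ∧ 0 ≤ C ∧ Decays … C δ` (`AxialDressing.decays_axDressK`). -/
theorem decayDatum_axDressK (hn : 1 ≤ n) (hKd : ∃ δ C : ℝ, 0 < δ ∧ 0 ≤ C ∧ Decays K C δ) :
    ∃ δ C : ℝ, 0 < δ ∧ 0 ≤ C ∧ Decays (axDressK n K) C δ := by
  obtain ⟨δ, C, hδ, hC, hK⟩ := hKd
  exact ⟨δ, _, hδ, mul_nonneg (cAx_nonneg 3 n δ) (mul_nonneg (cAx_nonneg 3 n δ) hC), decays_axDressK hn hK hδ.le⟩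

/-- **WARD TRANSVERSALITY OF THE FLIPPED ONE-STEP POLARIZATION KERNEL `TPerfOf n K S W` FROM an1's FOUR COARSE LETTERS** (letter (W) in an1's literal shape
over `vertexOfK (axDressK n K) n S`).  BINDERS: blocking `n ≥ 1`; a decaying, coarse-translation-invariant packed leg `K`; local stencils `S` with (St); second-order
tables `W` with (Wt); spread `𝕄`, `E` with (K) `RelInv (axDressK n K) 𝕄 E`; (H) the ℋ-column Ward law of the dressed leg with constant `c_H`; a localised generator
family `X y` and contact family `X₂ y ν y′` commuting with `E`, a localised tadpole-null remainder `Nr y ν y′`; (S) the block-stencil Ward law with contact; (W) the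
second-order pure-gauge law.  CONCLUSION: `WardTransversal (flipK (TPerfOf n K S W))` — the socket `hWperf` of `FP/StepLawWardPerf`.  All letters are
HYPOTHESES, never facts; = an1's `KernelWardRelative.wardTransversal_flipK_hessKer_conj_rel` at `K := axDressK n K`. [our object] -/
theorem wardTransversal_flipK_TPerfOf_of_letters' (hn : 1 ≤ n)
    (hKd : ∃ δ C : ℝ, 0 < δ ∧ 0 ≤ C ∧ Decays K C δ) (hKs : ∀ t : Fin (3 + 1) → ℤ, shiftK (-((n : ℤ) • t)) K = K)
    (hS : LocStencil S Cs δS) (hδS : 0 < δS) (hW : VertexFamily₂ W n Cw δW) (hδW : 0 < δW)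
    (hSt : ∀ (κ' : Fin (3 + 1)) (u t : Fin (3 + 1) → ℤ), S κ' (u + (n : ℤ) • t) = shiftK (-((n : ℤ) • t)) (S κ' u))
    (hWt : ∀ (μ : Fin (3 + 1)) (y : Fin (3 + 1) → ℤ) (ν : Fin (3 + 1)) (y' t : Fin (3 + 1) → ℤ),
      W μ (y + t) ν (y' + t) = shiftK (-((n : ℤ) • t)) (W μ y ν y'))
    (hM : Spr M) (hE : Spr E) (hR : RelInv (axDressK n K) M E)
    (cH : ℝ) (hH : ∀ (y : Fin (3 + 1) → ℤ) (κ' : Fin (3 + 1)) (u : Fin (3 + 1) → ℤ),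
      ∑ μ, (colH (axDressK n K) n μ (y - unitVec μ) κ' u - colH (axDressK n K) n μ y κ' u) = cH * gaugeWt n y κ' u)
    (X : (Fin (3 + 1) → ℤ) → MKer (3 + 1) (Fib 3)) (hX : ∀ y, Loc (X y)) (hEX : ∀ y, comp E (X y) = comp (X y) E)
    (X₂ Nr : (Fin (3 + 1) → ℤ) → Fin (3 + 1) → (Fin (3 + 1) → ℤ) → MKer (3 + 1) (Fib 3)) (hX₂ : ∀ y ν y', Loc (X₂ y ν y'))
    (hNr : ∀ y ν y', Loc (Nr y ν y')) (hEX₂ : ∀ y ν y', comp E (X₂ y ν y') = comp (X₂ y ν y') E)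
    (hSd : ∀ y : Fin (3 + 1) → ℤ, cH • ∑ v ∈ box (3 + 1) n, divV S ((n : ℤ) • y + toSite v) = conjV M (X y))
    (hWd : ∀ (y : Fin (3 + 1) → ℤ) (ν : Fin (3 + 1)) (y' : Fin (3 + 1) → ℤ),
      divW W y ν y' = conjW M 0 (vertexOfK (axDressK n K) n S ν y') (X y) 0 (X₂ y ν y') + Nr y ν y')
    (hN0 : ∀ y ν y', tadpole (axDressK n K) (Nr y ν y') = 0) :
    WardTransversal (flipK (TPerfOf n K S W)) := by
  -- an1's packed END at `K := Π K Π` (decay `decayDatum_axDressK`, coarse invariance `axDressK_blockCov`) with the jet datum `⟨S, W⟩` at the common rate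
  -- `min δS δW` (constants `|Cs|`, `|Cw|`, `TameKernelCalculus.biLoc_of_le`), read on `TPerfOf` by §1; cf. leaf-01-g6's generic-shape wrapper
  -- `LetterInheritanceEnd.wardTransversal_flipK_hessKer_vertexOfK_of_letters` (one common rate), of which this is the comb instance.
  have h := wardTransversal_flipK_hessKer_conj_rel (N := n) (decayDatum_axDressK hn hKd) (axDressK_blockCov hn hKs) hn hM hE hR
    ⟨S, W, |Cs|, |Cw|, min δS δW, lt_min hδS hδW, fun κ' u => biLoc_of_le (hS κ' u) (min_le_left _ _),
      fun μ y ν y' => biLoc_of_le (hW μ y ν y') (min_le_right _ _)⟩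
    hSt hWt cH hH X hX hEX X₂ Nr hX₂ hNr hEX₂ hSd hWd hN0
  rw [TPerfOf_eq_hessKer_vertexOfK]
  exact h

/-- **WARD TRANSVERSALITY OF THE FLIPPED ONE-STEP POLARIZATION KERNEL `TPerfOf n K S W` FROM an1's FOUR COARSE LETTERS** — letter (W) displayed over road FP's own
dressed vertex `axVertexOfK K n S` (`= vertexOfK (axDressK n K) n S`, §1).  Same binders and conclusion as `…_of_letters'`. [our object] -/
theorem wardTransversal_flipK_TPerfOf_of_letters (hn : 1 ≤ n)
    (hKd : ∃ δ C : ℝ, 0 < δ ∧ 0 ≤ C ∧ Decays K C δ) (hKs : ∀ t : Fin (3 + 1) → ℤ, shiftK (-((n : ℤ) • t)) K = K)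
    (hS : LocStencil S Cs δS) (hδS : 0 < δS) (hW : VertexFamily₂ W n Cw δW) (hδW : 0 < δW)
    (hSt : ∀ (κ' : Fin (3 + 1)) (u t : Fin (3 + 1) → ℤ), S κ' (u + (n : ℤ) • t) = shiftK (-((n : ℤ) • t)) (S κ' u))
    (hWt : ∀ (μ : Fin (3 + 1)) (y : Fin (3 + 1) → ℤ) (ν : Fin (3 + 1)) (y' t : Fin (3 + 1) → ℤ),
      W μ (y + t) ν (y' + t) = shiftK (-((n : ℤ) • t)) (W μ y ν y'))
    (hM : Spr M) (hE : Spr E) (hR : RelInv (axDressK n K) M E)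
    (cH : ℝ) (hH : ∀ (y : Fin (3 + 1) → ℤ) (κ' : Fin (3 + 1)) (u : Fin (3 + 1) → ℤ),
      ∑ μ, (colH (axDressK n K) n μ (y - unitVec μ) κ' u - colH (axDressK n K) n μ y κ' u) = cH * gaugeWt n y κ' u)
    (X : (Fin (3 + 1) → ℤ) → MKer (3 + 1) (Fib 3)) (hX : ∀ y, Loc (X y)) (hEX : ∀ y, comp E (X y) = comp (X y) E)
    (X₂ Nr : (Fin (3 + 1) → ℤ) → Fin (3 + 1) → (Fin (3 + 1) → ℤ) → MKer (3 + 1) (Fib 3)) (hX₂ : ∀ y ν y', Loc (X₂ y ν y'))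
    (hNr : ∀ y ν y', Loc (Nr y ν y')) (hEX₂ : ∀ y ν y', comp E (X₂ y ν y') = comp (X₂ y ν y') E)
    (hSd : ∀ y : Fin (3 + 1) → ℤ, cH • ∑ v ∈ box (3 + 1) n, divV S ((n : ℤ) • y + toSite v) = conjV M (X y))
    (hWd : ∀ (y : Fin (3 + 1) → ℤ) (ν : Fin (3 + 1)) (y' : Fin (3 + 1) → ℤ),
      divW W y ν y' = conjW M 0 (axVertexOfK K n S ν y') (X y) 0 (X₂ y ν y') + Nr y ν y')
    (hN0 : ∀ y ν y', tadpole (axDressK n K) (Nr y ν y') = 0) :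
    WardTransversal (flipK (TPerfOf n K S W)) := by
  refine wardTransversal_flipK_TPerfOf_of_letters' hn hKd hKs hS hδS hW hδW hSt hWt hM hE hR cH hH X hX hEX X₂ Nr hX₂ hNr hEX₂ hSd
    (fun y ν y' => ?_) hN0
  rw [vertexOfK_axDressK]
  exact hWd y ν y'

end Letters



end Summit.QuantumFields.BalabanUV.Beta.FP.PerfectWardLetters

end
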